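import Summits.Ventures.PercRepro.RankLevelSetBiIndepPaving
import Summits.Ventures.PercRepro.RankLevelSetBiIndepLRUniform

/-! # RankLevelSetBiIndepLRPaving — EVERY PAVING MATROID SATISFIES THE LIKELIHOOD-RATIO MONOTONICITY (LR)
(night-1 g27; dossier §39)

For a PAVING matroid `M` (`Paving M`: every subset of the ground set with fewer elements than the rank is
independent — uniform and sparse paving matroids included) the marked bi-independent profiles at `y ∈ E`
(`a_k = yThroughCount M y k = #{Q ∈ D_{k+1} : y ∈ Q}`, `b_k = yAvoidCount M y k = #{Z ∈ D_k : y ∉ Z}`) are FULL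
binomial rows inside the window of sizes strictly between the nullity and the rank, and the TP2 inequality
`a_q · b_p ≤ a_p · b_q` (`p ≤ q`) is a boundary-level statement:
* `yThroughCount_le_choose`, `yAvoidCount_le_choose`: in EVERY finite matroid `a_q ≤ C(n−1, q)` and
  `b_p ≤ C(n−1, p)` (`Q ↦ Q ∖ {y}`, and the avoiding sets are `p`-subsets of `E ∖ {y}`);
* `choose_le_yThroughCount_of_paving`, `choose_le_yAvoidCount_of_paving`: in a paving matroid `a_p = C(n−1, p)` as
  soon as `p + 1 < rank` and `n − (p+1) < rank` (every `Y ∪ {y}` with `Y` a `p`-subset of `E ∖ {y}` is independent, and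
  so is its complement), and `b_q = C(n−1, q)` as soon as `q < rank` and `n − q < rank`;
* **`biIndepLR_of_paving`**: `Paving M → BiIndepLR M`. For `p < q` with `a_q ≠ 0` and `b_p ≠ 0` a bi-independent
  `(q+1)`-set through `y` gives `q + 1 ≤ rank` and a bi-independent `p`-set avoiding `y` gives `n − p ≤ rank`, which
  puts `p` and `q` in the windows above: `a_q · b_p ≤ C(n−1, q) · C(n−1, p) = a_p · b_q`. When `a_q = 0` or `b_p = 0` the
  left side vanishes; `p = q` is trivial.
So, with `biIndepPerElem_of_LR`, (LR) ⟹ (★★) ⟹ the monotone profile and the global level-wise theorems hold on every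
paving matroid — the second proof of `biIndepPerElem_of_paving` — and the (LR)-class of `RankLevelSetBiIndepLR` now
contains, unconditionally: every uniform matroid, the whole model family and every paving matroid. Nothing here
asserts (LR) beyond the paving class; every declaration has a docstring; imports: the cell's own modules and Mathlib
only. Axioms: standard. -/

namespace PercRepro

open Set Matroid

variable {α : Type} (M : Matroid α) [M.Finite]

/-- `E ∖ {y}` is finite and has `#E − 1` elements when `y ∈ E`. -/
lemma ncard_ground_sdiff_singleton {y : α} (hy : y ∈ M.E) : (M.E \ {y}).ncard = M.E.ncard - 1 := by
  rw [Set.ncard_sdiff' (Set.singleton_subset_iff.mpr hy) M.ground_finite, Set.ncard_singleton]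

/-- **The trivial upper bound on the through-`y` count**: `a_q ≤ C(#E − 1, q)` in every finite matroid — `Q ↦ Q ∖ {y}`
injects the bi-independent `(q+1)`-sets through `y` into the `q`-subsets of `E ∖ {y}`. -/
lemma yThroughCount_le_choose {y : α} (hy : y ∈ M.E) (q : ℕ) :
    yThroughCount M y q ≤ (M.E.ncard - 1).choose q := by
  have hE' : (M.E \ {y}).Finite := M.ground_finite.subset Set.sdiff_subset
  rw [← ncard_ground_sdiff_singleton M hy, ← ncard_subsets_of_finite hE' q]
  unfold yThroughCount
  refine Set.ncard_le_ncard_of_injOn (fun Q => Q \ {y}) ?_ ?_ ?_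
  · rintro Q ⟨hQ, hyQ⟩
    refine ⟨Set.sdiff_subset_sdiff_left hQ.1, ?_⟩
    rw [Set.ncard_sdiff' (Set.singleton_subset_iff.mpr hyQ) (M.ground_finite.subset hQ.1), Set.ncard_singleton,
      hQ.2.1]
    rfl
  · rintro Q ⟨-, hyQ⟩ Q' ⟨-, hyQ'⟩ hQQ'
    have e : Q = insert y (Q \ {y}) := (Set.insert_sdiff_singleton.trans (Set.insert_eq_of_mem hyQ)).symm
    have e' : Q' = insert y (Q' \ {y}) := (Set.insert_sdiff_singleton.trans (Set.insert_eq_of_mem hyQ')).symm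
    simp only at hQQ'
    rw [e, e', hQQ']
  · exact hE'.finite_subsets.subset (fun Y hY => hY.1)

/-- **The trivial upper bound on the avoid-`y` count**: `b_p ≤ C(#E − 1, p)` in every finite matroid — the
bi-independent `p`-sets avoiding `y` are `p`-subsets of `E ∖ {y}`. -/
lemma yAvoidCount_le_choose {y : α} (hy : y ∈ M.E) (p : ℕ) :
    yAvoidCount M y p ≤ (M.E.ncard - 1).choose p := by
  have hE' : (M.E \ {y}).Finite := M.ground_finite.subset Set.sdiff_subset
  rw [← ncard_ground_sdiff_singleton M hy, ← ncard_subsets_of_finite hE' p]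
  unfold yAvoidCount
  refine Set.ncard_le_ncard ?_ (hE'.finite_subsets.subset (fun Y hY => hY.1))
  rintro Z ⟨hZ, hyZ⟩
  exact ⟨fun x hx => ⟨hZ.1 hx, fun hxy => hyZ (hxy ▸ hx)⟩, hZ.2.1⟩

/-- **The full row of the through-`y` count in a paving matroid**: if `p + 1 < rank` and `#E − (p + 1) < rank` then
every `p`-subset `Y` of `E ∖ {y}` gives the bi-independent `(p+1)`-set `Y ∪ {y}` through `y`, so `C(#E − 1, p) ≤ a_p`. -/
lemma choose_le_yThroughCount_of_paving (h : Paving M) {y : α} (hy : y ∈ M.E) {p : ℕ}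
    (hp1 : ((p + 1 : ℕ) : ℕ∞) < M.eRank) (hp2 : ((M.E.ncard - (p + 1) : ℕ) : ℕ∞) < M.eRank) :
    (M.E.ncard - 1).choose p ≤ yThroughCount M y p := by
  have hE' : (M.E \ {y}).Finite := M.ground_finite.subset Set.sdiff_subset
  rw [← ncard_ground_sdiff_singleton M hy, ← ncard_subsets_of_finite hE' p]
  unfold yThroughCount
  refine Set.ncard_le_ncard_of_injOn (fun Y => insert y Y) ?_ ?_ ?_
  · rintro Y ⟨hYE, hYcard⟩
    have hyY : y ∉ Y := fun hmem => (hYE hmem).2 rfl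
    have hYfin : Y.Finite := hE'.subset hYE
    have hcard : (insert y Y).ncard = p + 1 := by
      rw [Set.ncard_insert_of_notMem hyY hYfin, hYcard]
    have hsub : insert y Y ⊆ M.E := Set.insert_subset hy (hYE.trans Set.sdiff_subset)
    refine ⟨⟨hsub, hcard, ?_, ?_⟩, Set.mem_insert y Y⟩
    · refine paving_indep_of_encard_lt M h hsub ?_
      rw [← Set.Finite.cast_ncard_eq (hYfin.insert y), hcard]
      exact hp1
    · refine paving_indep_of_encard_lt M h Set.sdiff_subset ?_
      rw [← Set.Finite.cast_ncard_eq (M.ground_finite.subset Set.sdiff_subset),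
        Set.ncard_sdiff' hsub M.ground_finite, hcard]
      exact hp2
  · rintro Y ⟨hYE, -⟩ Y' ⟨hYE', -⟩ hYY'
    have hyY : y ∉ Y := fun hmem => (hYE hmem).2 rfl
    have hyY' : y ∉ Y' := fun hmem => (hYE' hmem).2 rfl
    simp only at hYY'
    have hd : insert y Y \ {y} = insert y Y' \ {y} := by rw [hYY']
    rwa [Set.insert_sdiff_of_mem _ (Set.mem_singleton y), Set.sdiff_singleton_eq_self hyY,
      Set.insert_sdiff_of_mem _ (Set.mem_singleton y), Set.sdiff_singleton_eq_self hyY'] at hd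
  · exact (biIndep_finite M (p + 1)).subset (fun Q hQ => hQ.1)

/-- **The full row of the avoid-`y` count in a paving matroid**: if `q < rank` and `#E − q < rank` then every
`q`-subset of `E ∖ {y}` is bi-independent and avoids `y`, so `C(#E − 1, q) ≤ b_q`. -/
lemma choose_le_yAvoidCount_of_paving (h : Paving M) {y : α} (hy : y ∈ M.E) {q : ℕ}
    (hq1 : ((q : ℕ) : ℕ∞) < M.eRank) (hq2 : ((M.E.ncard - q : ℕ) : ℕ∞) < M.eRank) :
    (M.E.ncard - 1).choose q ≤ yAvoidCount M y q := by
  have hE' : (M.E \ {y}).Finite := M.ground_finite.subset Set.sdiff_subset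
  rw [← ncard_ground_sdiff_singleton M hy, ← ncard_subsets_of_finite hE' q]
  unfold yAvoidCount
  refine Set.ncard_le_ncard ?_ ((biIndep_finite M q).subset (fun Z hZ => hZ.1))
  rintro Z ⟨hZE, hZcard⟩
  have hyZ : y ∉ Z := fun hmem => (hZE hmem).2 rfl
  have hZfin : Z.Finite := hE'.subset hZE
  have hsub : Z ⊆ M.E := hZE.trans Set.sdiff_subset
  refine ⟨⟨hsub, hZcard, ?_, ?_⟩, hyZ⟩
  · refine paving_indep_of_encard_lt M h hsub ?_
    rw [← Set.Finite.cast_ncard_eq hZfin, hZcard]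
    exact hq1
  · refine paving_indep_of_encard_lt M h Set.sdiff_subset ?_
    rw [← Set.Finite.cast_ncard_eq (M.ground_finite.subset Set.sdiff_subset),
      Set.ncard_sdiff' hsub M.ground_finite, hZcard]
    exact hq2

/-- A bi-independent `(q+1)`-set gives `q + 1 ≤ rank`. -/
lemma succ_le_eRank_of_mem_biIndep {q : ℕ} {Q : Set α} (hQ : Q ∈ biIndep M (q + 1)) :
    ((q + 1 : ℕ) : ℕ∞) ≤ M.eRank := by
  obtain ⟨hQE, hcard, hind, -⟩ := hQ
  have hfin : Q.Finite := M.ground_finite.subset hQE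
  rw [← hcard, Set.Finite.cast_ncard_eq hfin]
  exact hind.encard_le_eRank

/-- **EVERY PAVING MATROID SATISFIES (LR)**: `Paving M → BiIndepLR M`. For `p < q` with both `a_q` and `b_p`
nonzero, `q + 1 ≤ rank` and `#E − p ≤ rank`, so `a_p` and `b_q` are full binomial rows and the trivial upper bounds on
`a_q`, `b_p` give `a_q · b_p ≤ C(#E−1, q) · C(#E−1, p) = a_p · b_q`. -/
theorem biIndepLR_of_paving (h : Paving M) : BiIndepLR M := by
  intro y hy p q hpq
  rcases Nat.eq_or_lt_of_le hpq with rfl | hlt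
  · exact le_rfl
  by_cases ha : yThroughCount M y q = 0
  · rw [ha, zero_mul]; exact Nat.zero_le _
  by_cases hb : yAvoidCount M y p = 0
  · rw [hb, mul_zero]; exact Nat.zero_le _
  obtain ⟨Q₀, hQ₀, -⟩ := Set.nonempty_of_ncard_ne_zero ha
  obtain ⟨Z₀, hZ₀, -⟩ := Set.nonempty_of_ncard_ne_zero hb
  have hqr : ((q + 1 : ℕ) : ℕ∞) ≤ M.eRank := succ_le_eRank_of_mem_biIndep M hQ₀
  have hpr : ((M.E.ncard - p : ℕ) : ℕ∞) ≤ M.eRank := biIndep_compl_encard_le_eRank M hZ₀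
  have hqn : q + 1 ≤ M.E.ncard := by
    rw [← hQ₀.2.1]; exact Set.ncard_le_ncard hQ₀.1 M.ground_finite
  have hp1 : ((p + 1 : ℕ) : ℕ∞) < M.eRank := by
    have : ((p + 1 : ℕ) : ℕ∞) < ((q + 1 : ℕ) : ℕ∞) := by exact_mod_cast (by omega : p + 1 < q + 1)
    exact lt_of_lt_of_le this hqr
  have hp2 : ((M.E.ncard - (p + 1) : ℕ) : ℕ∞) < M.eRank := by
    have : ((M.E.ncard - (p + 1) : ℕ) : ℕ∞) < ((M.E.ncard - p : ℕ) : ℕ∞) := by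
      exact_mod_cast (by omega : M.E.ncard - (p + 1) < M.E.ncard - p)
    exact lt_of_lt_of_le this hpr
  have hq1 : ((q : ℕ) : ℕ∞) < M.eRank := by
    have : ((q : ℕ) : ℕ∞) < ((q + 1 : ℕ) : ℕ∞) := by exact_mod_cast (by omega : q < q + 1)
    exact lt_of_lt_of_le this hqr
  have hq2 : ((M.E.ncard - q : ℕ) : ℕ∞) < M.eRank := by
    have : ((M.E.ncard - q : ℕ) : ℕ∞) < ((M.E.ncard - p : ℕ) : ℕ∞) := by
      exact_mod_cast (by omega : M.E.ncard - q < M.E.ncard - p)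
    exact lt_of_lt_of_le this hpr
  calc yThroughCount M y q * yAvoidCount M y p
      ≤ (M.E.ncard - 1).choose q * (M.E.ncard - 1).choose p :=
        Nat.mul_le_mul (yThroughCount_le_choose M hy q) (yAvoidCount_le_choose M hy p)
    _ = (M.E.ncard - 1).choose p * (M.E.ncard - 1).choose q := mul_comm _ _
    _ ≤ yThroughCount M y p * yAvoidCount M y q :=
        Nat.mul_le_mul (choose_le_yThroughCount_of_paving M h hy hp1 hp2)
          (choose_le_yAvoidCount_of_paving M h hy hq1 hq2)

/-- **The consecutive form on paving matroids**. -/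
theorem biIndepLRStep_of_paving (h : Paving M) : BiIndepLRStep M :=
  fun y hy p => biIndepLR_of_paving M h y hy p (p + 1) (Nat.le_succ p)

/-- **(★★) on paving matroids through (LR)** — a second proof of `biIndepPerElem_of_paving`. -/
theorem biIndepPerElem_of_paving_of_LR (h : Paving M) : BiIndepPerElem M :=
  biIndepPerElem_of_LR M (biIndepLR_of_paving M h)

end PercRepro
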